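import Summits.RiemannHypothesis.RiemannHypothesis.Theorems.Splittings.JensenShiftMonoCorner
import Literature.Barriers.RiemannHypothesis.JensenPolynomialsLogConcaveKernel
import HarnessLib

/-!
# The TWO-ZERO EXPONENTIAL MODEL of the X-4 splitting, decided cell by cell (jen-neg g5, §§1–5: the model grid, conjuncts A and B)

Cell rh-split, seat rh-split-jen-neg g5 (brief sha16 f79c5f09d8bcb036), card `run/shared/lean/pub/rh-split/cards/SPLIT-jen-neg.md`
ADDENDUM 6 + SUPPLEMENT S1; kernel `HOME/rh-split-jen-neg/g5/SketchG5Model.lean` sha16 1f91847e4bb642aa (§§1–5 byte-identical to the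
earlier 0b4d1b6586aaf0bd), referee rh-split-ref g3 replay PASS + labels 2026-08-27T05:21:06Z / 05:42:39Z (S1), lead rh-split-lead g3 RULING
#22/#22a (vii)(α) («Theorems/Splittings, NOT Literature/Barriers»); filed by rh-split-typer-2 g4 in two zero-def files (this = §§1–5;
`JensenX4TwoZeroKernel.lean` = §6), decl blocks byte-verbatim except that `splits_of_le_one` is made `private` (gate dedup: it restates the landed
`Theorems.SoloBlindJensenShift.soloBlind_jensenPoly_splits_of_le_one`), namespace `…Splittings.JensenX4TwoZeroModel` (scratch: `RhSplitJenNegG5`).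

HONEST LABEL: «SPLITTING SEARCH over kernel-typed RH-EQUIVALENCES; a splitting A ∧ B ⟹ RH is CONDITIONAL bookkeeping unless A and B are
both proved; nothing here bears on the truth of RH.»  Everything in this file is about the MODEL sequence `γ_{u,ν}(m) = (m − u)² − m + ν`
(Taylor sequence of `E_{u,ν}(w) = e^w((w − u)² + ν)`, zeros `u ± i√ν`), NOT about `xiTaylorCoeff`; labels MODEL (exact, kernel).

The seat's summary (§§1–5):

X-4 (tree `JensenDerivativeLaguerre.rh_iff_rowsFromOne_and_rowZeroLaguerre`): RH ⟺ A ∧ B with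
A = RowsFromOne (`∀ d n, 1 ≤ n → J^{d,n}_γ hyperbolic`), B = RowZeroLaguerre (strict Laguerre sign law at the real
critical points of every `J^{d,0}_γ`, `d ≥ 2`).  For the model family (u ≤ 0, ν > 0 = «zero pair in the closed
left half-plane, off the axis», the ξ-like geometry) this file PROVES:

* `jensenPoly_eq_of_newton` — Newton-form factorisation of the whole Jensen grid of ANY sequence that is quadratic
  from the shift on: `J^{e+2,n}_γ = (X+1)^e · (quadratic)`;
* `model_splits_iff` — cell `(e+2, n)` of the model grid is hyperbolic iff `0 ≤ (n − u)² + (e+1)(n − ν)` («csc² law»);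
* `model_row_iff` (row `n` hyperbolic iff `ν ≤ n`), `model_rowsFromOne_iff` (A iff `ν ≤ 1`), `model_not_allHyperbolic`,
  `model_rowZero_threshold`; `model_not_rowZeroLaguerre` — B FAILS for every member at degree `δ(0) = ⌊u²/ν⌋ + 2`;
  `model_laguerreAt_iff` — B is DECIDED at every degree;
* `quadExpCoeff_eq_model` — the tree's Farmer-barrier witness `quadExp` is the member `(u,ν) = (0,1)`; `qSeq_eq_model` /
  `splits_jensenPoly_K_zero_iff_model` — the Dimitrov–Lucas log-concave refutation kernel `K_0` is, up to rescaling, the FAR-PAIR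
  member `(u*,ν*) = (−1147/98, 374797/4802)`.

PRINT / TREE POSITION (honest).  The hyperbolic direction `d ≤ csc² θ_n ⟹ J^{d,n} hyperbolic` is OBRESCHKOFF's sector law (1961;
Kim–Lee arXiv:2105.05386 Thm. 3 + Cor.; tree `Literature.Analysis.Complex.Obreschkoff.*`, `KimLee.splits_jensenPoly_exp_mul`), and its
sharpness at ROW 0 for the exponential-free lone quadratic is the tree's `JensenLoneQuad.splits_jensenPoly_loneQuad_iff` /
`sector_constant_sharp`.  New here: the e^w-dressed ALL-SHIFTS closed form and the decision of conjunct B and of the A/B/𝓛𝓟 regions.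
LABELS (referee g3): MODEL/KERNEL RH-FREE; labels of record for (jen, neg) unchanged.  Nothing here is a claim about the truth of RH.
-/

set_option linter.dupNamespace false

noncomputable section

open Polynomial
open Literature.NumberTheory.LFunctions

namespace Summit.RiemannHypothesis.RiemannHypothesis.Theorems.Splittings.JensenX4TwoZeroModel

/-! ## §1 Newton-form factorisation of the Jensen grid of a quadratic sequence -/

/-- If `γ(n+j) = a + b·j + c·j(j−1)` for all `j` (Newton form at the shift `n`), then for every `e`,
`J^{e+2,n}_γ = (X+1)^e · ( (a + b(e+2) + c(e+2)(e+1)) X² + (2a + b(e+2)) X + a )`.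
(General-parameter form of the tree's `LogConcaveKernel.jensenPoly_qSeq_eq`; same proof.) [folklore] -/
theorem jensenPoly_eq_of_newton (γ : ℕ → ℝ) (n : ℕ) (a b c : ℝ)
    (hγ : ∀ j : ℕ, γ (n + j) = a + b * (j : ℝ) + c * ((j : ℝ) * ((j : ℝ) - 1))) (e : ℕ) :
    jensenPoly γ (e + 2) n =
      (X + 1) ^ e * (C (a + b * ((e : ℝ) + 2) + c * (((e : ℝ) + 2) * ((e : ℝ) + 1))) * X ^ 2 +
        C (2 * a + b * ((e : ℝ) + 2)) * X + C a) := by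
  ext k
  have hR : (X + 1) ^ e * (C (a + b * ((e : ℝ) + 2) + c * (((e : ℝ) + 2) * ((e : ℝ) + 1))) * X ^ 2 +
        C (2 * a + b * ((e : ℝ) + 2)) * X + C a) =
      C (a + b * ((e : ℝ) + 2) + c * (((e : ℝ) + 2) * ((e : ℝ) + 1))) * ((X + 1) ^ e * X ^ 2) +
        C (2 * a + b * ((e : ℝ) + 2)) * ((X + 1) ^ e * X ^ 1) + C a * (X + 1) ^ e := by
    rw [pow_one]; ring
  rw [hR, Literature.Barriers.RiemannHypothesis.coeff_jensenPoly, coeff_add, coeff_add, coeff_C_mul, coeff_C_mul,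
    coeff_C_mul, coeff_mul_X_pow', coeff_mul_X_pow', coeff_X_add_one_pow]
  rcases k with _ | _ | k
  · have h0 := hγ 0
    simp only [Nat.cast_zero, mul_zero, zero_sub, zero_mul, add_zero] at h0
    simp [coeff_X_add_one_pow, h0]
  · simp only [zero_add, Nat.choose_one_right,
      show ¬ (2 ≤ 0 + 1) from by omega, if_false, if_true, le_refl, Nat.sub_self, coeff_X_add_one_pow,
      Nat.choose_zero_right, Nat.choose_one_right, Nat.cast_one, mul_zero, zero_add, mul_one]
    have h0 := hγ 1
    push_cast at h0 ⊢
    linear_combination ((e : ℝ) + 2) * h0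
  · simp only [show 2 ≤ k + 2 from by omega, show 1 ≤ k + 2 from by omega, if_true,
      show k + 2 - 2 = k from by omega, show k + 2 - 1 = k + 1 from by omega, coeff_X_add_one_pow]
    by_cases hk : k ≤ e
    · have h0 := hγ (k + 2)
      have h1 : ((e + 2).choose (k + 2) : ℝ) =
          (e.choose k : ℝ) + 2 * (e.choose (k + 1) : ℝ) + (e.choose (k + 2) : ℝ) := by
        have := Nat.choose_succ_succ' (e + 1) (k + 1)
        have h' := Nat.choose_succ_succ' e k
        have h'' := Nat.choose_succ_succ' e (k + 1)
        push_cast [this, h', h'']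
        ring
      have h2 : ((k : ℝ) + 2) * ((e + 2).choose (k + 2) : ℝ) =
          ((e : ℝ) + 2) * ((e.choose k : ℝ) + (e.choose (k + 1) : ℝ)) := by
        have := Nat.add_one_mul_choose_eq (e + 1) (k + 1)
        have h' := Nat.choose_succ_succ' e k
        have hc : ((e + 1 + 1) : ℝ) * ((e + 1).choose (k + 1) : ℝ) =
            ((e + 1 + 1).choose (k + 1 + 1) : ℝ) * ((k : ℝ) + 1 + 1) := by exact_mod_cast this
        push_cast [h'] at hc
        linear_combination -hc
      have h3 : ((k : ℝ) + 2) * ((k : ℝ) + 1) * ((e + 2).choose (k + 2) : ℝ) =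
          ((e : ℝ) + 2) * ((e : ℝ) + 1) * (e.choose k : ℝ) := by
        have ha := Nat.add_one_mul_choose_eq (e + 1) (k + 1)
        have hb := Nat.add_one_mul_choose_eq e k
        have hc : ((e + 1 + 1) : ℝ) * ((e + 1).choose (k + 1) : ℝ) =
            ((e + 1 + 1).choose (k + 1 + 1) : ℝ) * ((k : ℝ) + 1 + 1) := by exact_mod_cast ha
        have hd : ((e + 1) : ℝ) * (e.choose k : ℝ) =
            ((e + 1).choose (k + 1) : ℝ) * ((k : ℝ) + 1) := by exact_mod_cast hb
        linear_combination -((k : ℝ) + 1) * hc - ((e : ℝ) + 2) * hd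
      rw [h0]
      push_cast
      linear_combination a * h1 + b * h2 + c * h3
    · rw [Nat.choose_eq_zero_of_lt (by omega : e + 2 < k + 2), Nat.choose_eq_zero_of_lt (by omega : e < k),
        Nat.choose_eq_zero_of_lt (by omega : e < k + 1), Nat.choose_eq_zero_of_lt (by omega : e < k + 2)]
      simp

/-! ## §2 The two-zero model `γ_{u,ν}(m) = (m − u)² − m + ν` and its grid -/

/-- Newton data of the model at the shift `n`: `γ(n+j) = a + 2(n−u)·j + 1·j(j−1)` with `a = (n−u)² − n + ν`.
[folklore] -/
theorem model_newton (u ν : ℝ) (n j : ℕ) :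
    (fun m : ℕ => ((m : ℝ) - u) ^ 2 - m + ν) (n + j) =
      (((n : ℝ) - u) ^ 2 - n + ν) + 2 * ((n : ℝ) - u) * (j : ℝ) + 1 * ((j : ℝ) * ((j : ℝ) - 1)) := by
  push_cast; ring

/-- The model grid factorised: `J^{e+2,n} = (X+1)^e · Q_{e,n}` with an explicit real quadratic `Q_{e,n}`. [folklore] -/
theorem model_factor (u ν : ℝ) (e n : ℕ) :
    jensenPoly (fun m : ℕ => ((m : ℝ) - u) ^ 2 - m + ν) (e + 2) n =
      (X + 1) ^ e * (C ((((n : ℝ) - u) ^ 2 - n + ν) + 2 * ((n : ℝ) - u) * ((e : ℝ) + 2) +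
            1 * (((e : ℝ) + 2) * ((e : ℝ) + 1))) * X ^ 2 +
        C (2 * (((n : ℝ) - u) ^ 2 - n + ν) + 2 * ((n : ℝ) - u) * ((e : ℝ) + 2)) * X +
          C (((n : ℝ) - u) ^ 2 - n + ν)) :=
  jensenPoly_eq_of_newton _ n _ _ _ (model_newton u ν n) e

/-- The discriminant of `Q_{e,n}`: `4(e+2)·[(n−u)² + (e+1)(n−ν)]`. [folklore] -/
theorem model_discrim (u ν : ℝ) (e n : ℕ) :
    discrim ((((n : ℝ) - u) ^ 2 - n + ν) + 2 * ((n : ℝ) - u) * ((e : ℝ) + 2) + 1 * (((e : ℝ) + 2) * ((e : ℝ) + 1)))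
        (2 * (((n : ℝ) - u) ^ 2 - n + ν) + 2 * ((n : ℝ) - u) * ((e : ℝ) + 2)) (((n : ℝ) - u) ^ 2 - n + ν) =
      4 * ((e : ℝ) + 2) * (((n : ℝ) - u) ^ 2 + ((e : ℝ) + 1) * ((n : ℝ) - ν)) := by
  rw [discrim]; ring

/-- In the ξ-like region `u ≤ 0 < ν` the model sequence is positive: `γ(m) ≥ ν > 0`. [folklore] -/
theorem model_pos {u ν : ℝ} (hu : u ≤ 0) (hν : 0 < ν) (m : ℕ) : 0 < ((m : ℝ) - u) ^ 2 - m + ν := by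
  have hm : (0 : ℝ) ≤ m := by positivity
  have hmm : (0 : ℝ) ≤ (m : ℝ) ^ 2 - m := by
    rcases Nat.eq_zero_or_pos m with rfl | h
    · simp
    · have : (1 : ℝ) ≤ m := by exact_mod_cast h
      nlinarith
  nlinarith

/-- The leading Newton coefficient of `Q_{e,n}` is `γ(n+e+2) > 0`. [folklore] -/
theorem model_lead_pos {u ν : ℝ} (hu : u ≤ 0) (hν : 0 < ν) (e n : ℕ) :
    0 < (((n : ℝ) - u) ^ 2 - n + ν) + 2 * ((n : ℝ) - u) * ((e : ℝ) + 2) + 1 * (((e : ℝ) + 2) * ((e : ℝ) + 1)) := by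
  have h := model_pos hu hν (n + (e + 2))
  have h' := model_newton u ν n (e + 2)
  simp only at h'
  push_cast at h h'
  linarith

/-- **The model grid, decided**: for `u ≤ 0 < ν`, the cell `(e+2, n)` is hyperbolic iff
`0 ≤ (n − u)² + (e+1)(n − ν)`.  (Cells of degree `≤ 1` are always hyperbolic.) [folklore] -/
theorem model_splits_iff {u ν : ℝ} (hu : u ≤ 0) (hν : 0 < ν) (e n : ℕ) :
    (jensenPoly (fun m : ℕ => ((m : ℝ) - u) ^ 2 - m + ν) (e + 2) n).Splits ↔
      0 ≤ ((n : ℝ) - u) ^ 2 + ((e : ℝ) + 1) * ((n : ℝ) - ν) := by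
  have hlead := model_lead_pos hu hν e n
  have hne : ((X : ℝ[X]) + 1) ^ e ≠ 0 := by
    apply pow_ne_zero; rw [← C_1]; exact X_add_C_ne_zero 1
  have hsp : (((X : ℝ[X]) + 1) ^ e).Splits := by
    simpa using (Splits.X_add_C (1 : ℝ)).pow e
  rw [model_factor, splits_mul_iff_right hne hsp,
    Literature.Barriers.RiemannHypothesis.splits_quadratic_iff_discrim_nonneg hlead.ne', model_discrim]
  have h4 : (0 : ℝ) < 4 * ((e : ℝ) + 2) := by positivity
  rw [mul_nonneg_iff_of_pos_left h4]

/-- Degree `≤ 1` cells are hyperbolic (any sequence). [folklore] -/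
private theorem splits_of_le_one (γ : ℕ → ℝ) {d : ℕ} (hd : d ≤ 1) (n : ℕ) : (jensenPoly γ d n).Splits :=
  Splits.of_natDegree_le_one ((Literature.NumberTheory.LFunctions.natDegree_jensenPoly_le γ d n).trans hd)

/-! ## §3 Rows, conjunct A, and the 𝓛𝓟-analogue -/

/-- **Row law**: for `u ≤ 0 < ν`, row `n` of the model grid is hyperbolic in every degree iff `ν ≤ n`
(`E^{(n)}_{u,ν} = e^w((w−u+n)² + … )` has real zeros iff `n ≥ ν = (Im w₀)²`). [folklore] -/
theorem model_row_iff {u ν : ℝ} (hu : u ≤ 0) (hν : 0 < ν) (n : ℕ) :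
    (∀ d : ℕ, (jensenPoly (fun m : ℕ => ((m : ℝ) - u) ^ 2 - m + ν) d n).Splits) ↔ ν ≤ n := by
  constructor
  · intro h
    by_contra hlt
    rw [not_le] at hlt
    obtain ⟨e, he⟩ := exists_nat_gt (((n : ℝ) - u) ^ 2 / (ν - n))
    have hpos : 0 < ν - n := by linarith
    have he' : ((n : ℝ) - u) ^ 2 < e * (ν - n) := by rwa [div_lt_iff₀ hpos] at he
    have hs := (model_splits_iff hu hν e n).1 (h (e + 2))
    nlinarith
  · intro hle d
    rcases Nat.lt_or_ge d 2 with hd | hd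
    · exact splits_of_le_one _ (by omega) n
    · obtain ⟨e, rfl⟩ := Nat.exists_eq_add_of_le' hd
      rw [model_splits_iff hu hν]
      have h1 : (0 : ℝ) ≤ ((e : ℝ) + 1) * ((n : ℝ) - ν) := mul_nonneg (by positivity) (by linarith)
      positivity

/-- **Conjunct A in the model**: RowsFromOne holds iff `ν ≤ 1` (iff `E′ ∈ 𝓛𝓟`, iff `Im w₀ ≤ 1`). [folklore] -/
theorem model_rowsFromOne_iff {u ν : ℝ} (hu : u ≤ 0) (hν : 0 < ν) :
    (∀ d n : ℕ, 1 ≤ n → (jensenPoly (fun m : ℕ => ((m : ℝ) - u) ^ 2 - m + ν) d n).Splits) ↔ ν ≤ 1 := by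
  constructor
  · intro h
    have := (model_row_iff hu hν 1).1 (fun d => h d 1 le_rfl)
    simpa using this
  · intro h d n hn
    have hn' : ν ≤ n := h.trans (by exact_mod_cast hn)
    exact (model_row_iff hu hν n).2 hn' d

/-- **The 𝓛𝓟-analogue fails**: some `J^{d,0}` of the model is not hyperbolic (row `0` needs `ν ≤ 0`). [folklore] -/
theorem model_not_allHyperbolic {u ν : ℝ} (hu : u ≤ 0) (hν : 0 < ν) :
    ¬ (∀ d n : ℕ, (jensenPoly (fun m : ℕ => ((m : ℝ) - u) ^ 2 - m + ν) d n).Splits) := by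
  intro h
  have := (model_row_iff hu hν 0).1 (fun d => h d 0)
  simp at this
  linarith

/-- The first failing degree of row `0` is EXACTLY `δ(0) = ⌊u²/ν⌋₊ + 2`: hyperbolic below, not at it. [folklore] -/
theorem model_rowZero_threshold {u ν : ℝ} (hu : u ≤ 0) (hν : 0 < ν) :
    (∀ d : ℕ, d ≤ ⌊u ^ 2 / ν⌋₊ + 1 → (jensenPoly (fun m : ℕ => ((m : ℝ) - u) ^ 2 - m + ν) d 0).Splits) ∧
      ¬ (jensenPoly (fun m : ℕ => ((m : ℝ) - u) ^ 2 - m + ν) (⌊u ^ 2 / ν⌋₊ + 2) 0).Splits := by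
  have hfl : (⌊u ^ 2 / ν⌋₊ : ℝ) ≤ u ^ 2 / ν := Nat.floor_le (by positivity)
  have hlt : u ^ 2 / ν < (⌊u ^ 2 / ν⌋₊ : ℝ) + 1 := Nat.lt_floor_add_one _
  have hfl' : (⌊u ^ 2 / ν⌋₊ : ℝ) * ν ≤ u ^ 2 := by rwa [le_div_iff₀ hν] at hfl
  have hlt' : u ^ 2 < ((⌊u ^ 2 / ν⌋₊ : ℝ) + 1) * ν := by rwa [div_lt_iff₀ hν] at hlt
  constructor
  · intro d hd
    rcases Nat.lt_or_ge d 2 with h2 | h2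
    · exact splits_of_le_one _ (by omega) 0
    · obtain ⟨e, rfl⟩ := Nat.exists_eq_add_of_le' h2
      rw [model_splits_iff hu hν]
      have he : (e : ℝ) + 1 ≤ ⌊u ^ 2 / ν⌋₊ := by exact_mod_cast (show e + 1 ≤ ⌊u ^ 2 / ν⌋₊ by omega)
      simp only [Nat.cast_zero, zero_sub]
      nlinarith
  · rw [model_splits_iff hu hν]
    push_cast
    nlinarith

/-! ## §4 Conjunct B (RowZeroLaguerre) in the model: decided -/

/-- **Conjunct B FAILS in the model** (every `u ≤ 0 < ν`): at `D = δ(0) = ⌊u²/ν⌋₊ + 2` row `1` is hyperbolic at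
degree `D − 1`, so by the MASK LEMMA (`JensenShiftMonoCorner.laguerreAt_iff_splits_of_rowOne`) `B(D)` is equivalent
to hyperbolicity of `J^{D,0}`, which fails.  Hence in the model `{B} = {𝓛𝓟}`: B is the critical conjunct, A has
slack (`0 < ν ≤ 1` gives A ∧ ¬B ∧ ¬𝓛𝓟). [folklore] -/
theorem model_not_rowZeroLaguerre {u ν : ℝ} (hu : u ≤ 0) (hν : 0 < ν) :
    ¬ (∀ d : ℕ, 2 ≤ d → ∀ x : ℝ,
        (derivative (jensenPoly (fun m : ℕ => ((m : ℝ) - u) ^ 2 - m + ν) d 0)).eval x = 0 →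
        (jensenPoly (fun m : ℕ => ((m : ℝ) - u) ^ 2 - m + ν) d 0).eval x ≠ 0 →
        (jensenPoly (fun m : ℕ => ((m : ℝ) - u) ^ 2 - m + ν) d 0).eval x *
          (derivative (derivative (jensenPoly (fun m : ℕ => ((m : ℝ) - u) ^ 2 - m + ν) d 0))).eval x < 0) := by
  intro hB
  obtain ⟨_, hfail⟩ := model_rowZero_threshold hu hν
  -- row 1 is hyperbolic at degree ⌊u²/ν⌋₊ + 1
  have hrow1 : (jensenPoly (fun m : ℕ => ((m : ℝ) - u) ^ 2 - m + ν) (⌊u ^ 2 / ν⌋₊ + 1) 1).Splits := by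
    rcases Nat.eq_zero_or_pos ⌊u ^ 2 / ν⌋₊ with h0 | hpos
    · rw [h0]; exact splits_of_le_one _ le_rfl 1
    · obtain ⟨e, he⟩ : ∃ e : ℕ, ⌊u ^ 2 / ν⌋₊ = e + 1 := ⟨⌊u ^ 2 / ν⌋₊ - 1, by omega⟩
      have hfl : ((⌊u ^ 2 / ν⌋₊ : ℕ) : ℝ) ≤ u ^ 2 / ν := Nat.floor_le (by positivity)
      have hfl' : ((⌊u ^ 2 / ν⌋₊ : ℕ) : ℝ) * ν ≤ u ^ 2 := by rwa [le_div_iff₀ hν] at hfl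
      have heN : (e : ℝ) + 1 = ((⌊u ^ 2 / ν⌋₊ : ℕ) : ℝ) := by rw [he]; push_cast; ring
      have key : ((e : ℝ) + 1) * ν ≤ u ^ 2 := by rw [heN]; exact hfl'
      rw [he, show e + 1 + 1 = e + 2 by ring, model_splits_iff hu hν]
      push_cast
      nlinarith [key, hu]
  have hγ : (fun m : ℕ => ((m : ℝ) - u) ^ 2 - m + ν) (⌊u ^ 2 / ν⌋₊ + 1 + 1) ≠ 0 := (model_pos hu hν _).ne'
  have hmask := Summit.RiemannHypothesis.RiemannHypothesis.Theorems.Splittings.JensenShiftMonoCorner.laguerreAt_iff_splits_of_rowOne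
    hγ hrow1
  have h2 : (jensenPoly (fun m : ℕ => ((m : ℝ) - u) ^ 2 - m + ν) (⌊u ^ 2 / ν⌋₊ + 2) 0).Splits :=
    hmask.1 (hB _ (by omega))
  exact hfail h2

/-- **B decided at every degree `D = e + 3 ≥ 3`**: `B(D)` holds iff row `1` is NOT hyperbolic at degree `D − 1`
(then `J^{D,0}` has no critical point off its zero `−1`: B is vacuous, «blind») or row `0` IS hyperbolic at degree
`D` (strict Laguerre).  With `model_splits_iff`: `B(e+3) ⟺ (1−u)² + (e+1)(1−ν) < 0 ∨ 0 ≤ u² − (e+2)ν`; the failure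
set of B is exactly the window `δ(0) ≤ D ≤ δ(1)` (`δ(1) = ∞` when `ν ≤ 1`). [folklore] -/
theorem model_laguerreAt_iff {u ν : ℝ} (hu : u ≤ 0) (hν : 0 < ν) (e : ℕ) :
    (∀ x : ℝ,
        (derivative (jensenPoly (fun m : ℕ => ((m : ℝ) - u) ^ 2 - m + ν) (e + 3) 0)).eval x = 0 →
        (jensenPoly (fun m : ℕ => ((m : ℝ) - u) ^ 2 - m + ν) (e + 3) 0).eval x ≠ 0 →
        (jensenPoly (fun m : ℕ => ((m : ℝ) - u) ^ 2 - m + ν) (e + 3) 0).eval x *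
          (derivative (derivative (jensenPoly (fun m : ℕ => ((m : ℝ) - u) ^ 2 - m + ν) (e + 3) 0))).eval x < 0)
      ↔ (((1 : ℝ) - u) ^ 2 + ((e : ℝ) + 1) * (1 - ν) < 0 ∨ 0 ≤ (0 - u) ^ 2 + ((e : ℝ) + 2) * (0 - ν)) := by
  set γ : ℕ → ℝ := fun m : ℕ => ((m : ℝ) - u) ^ 2 - m + ν with hγdef
  have hγne : γ (e + 2 + 1) ≠ 0 := (model_pos hu hν _).ne'
  by_cases h1 : 0 ≤ ((1 : ℝ) - u) ^ 2 + ((e : ℝ) + 1) * (1 - ν)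
  · -- row 1 hyperbolic at degree e+2 = D-1: mask lemma
    have hrow1 : (jensenPoly γ (e + 2) 1).Splits := by
      rw [hγdef, model_splits_iff hu hν]; push_cast; linarith
    have hmask := Summit.RiemannHypothesis.RiemannHypothesis.Theorems.Splittings.JensenShiftMonoCorner.laguerreAt_iff_splits_of_rowOne
      hγne hrow1
    rw [show e + 3 = e + 2 + 1 by ring, hmask, show e + 2 + 1 = (e + 1) + 2 by ring, hγdef, model_splits_iff hu hν]
    push_cast
    constructor
    · intro h; right; linarith
    · rintro (h | h)
      · exact absurd h1 (not_le.2 h)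
      · linarith
  · -- row 1 NOT hyperbolic at degree D-1: no critical point off the zero -1, B vacuous
    rw [not_le] at h1
    refine ⟨fun _ => Or.inl h1, fun _ => ?_⟩
    intro x hx hne
    exfalso
    -- derivative = (e+3) · J^{e+2,1} = (e+3)(X+1)^e Q₁
    have hder : derivative (jensenPoly γ (e + 3) 0) = C ((((e + 2 : ℕ) : ℝ)) + 1) * jensenPoly γ (e + 2) (0 + 1) := by
      rw [show e + 3 = (e + 2) + 1 by ring]
      exact Literature.Analysis.Complex.JensenLaguerreFlow.derivative_jensenPoly_succ γ (e + 2) 0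
    rw [hder, zero_add, hγdef, model_factor, eval_mul, eval_C, eval_mul, eval_pow] at hx
    have hc : (((e + 2 : ℕ) : ℝ) + 1) ≠ 0 := by positivity
    rcases mul_eq_zero.1 hx with h | h
    · exact hc h
    rcases mul_eq_zero.1 h with h | h
    · -- x = -1 (and e ≥ 1): then J^{e+3,0}(x) = 0
      have hx1 : x + 1 = 0 := by
        have := pow_eq_zero_iff (n := e) (M₀ := ℝ) (a := eval x (X + 1))
        by_cases he : e = 0
        · subst he; simp at h
        · have h' := (pow_eq_zero_iff he).1 h
          simpa using h'
      apply hne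
      rw [hγdef, show e + 3 = (e + 1) + 2 by ring, model_factor, eval_mul, eval_pow]
      simp [show eval x (X + 1 : ℝ[X]) = x + 1 by simp, hx1]
    · -- Q₁(x) = 0 forces disc Q₁ ≥ 0, contradicting row-1 failure
      have hq : ((((1 : ℕ) : ℝ) - u) ^ 2 - (1 : ℕ) + ν + 2 * (((1 : ℕ) : ℝ) - u) * ((e : ℝ) + 2) +
            1 * (((e : ℝ) + 2) * ((e : ℝ) + 1))) * (x * x) +
          (2 * ((((1 : ℕ) : ℝ) - u) ^ 2 - (1 : ℕ) + ν) + 2 * (((1 : ℕ) : ℝ) - u) * ((e : ℝ) + 2)) * x +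
          ((((1 : ℕ) : ℝ) - u) ^ 2 - (1 : ℕ) + ν) = 0 := by
        simp only [eval_add, eval_mul, eval_C, eval_pow, eval_X] at h
        linarith [h]
      have hd := discrim_eq_sq_of_quadratic_eq_zero hq
      rw [model_discrim] at hd
      have : 0 ≤ 4 * ((e : ℝ) + 2) * ((((1 : ℕ) : ℝ) - u) ^ 2 + ((e : ℝ) + 1) * (((1 : ℕ) : ℝ) - ν)) := by
        rw [hd]; positivity
      have h4 : (0 : ℝ) < 4 * ((e : ℝ) + 2) := by positivity
      rw [mul_nonneg_iff_of_pos_left h4] at this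
      push_cast at this
      linarith

/-! ## §5 The tree's Farmer witness is the A-critical member -/

/-- `quadExpCoeff = γ_{0,1}`: Farmer's barrier witness `(1+z²)eᶻ` of `JensenPolynomials.lean` is the member
`(u,ν) = (0,1)` of the family — the A-CRITICAL point `ν = 1` (rows `n ≥ 1` hyperbolic, row `0` fails from
`δ(0) = 2` on). [folklore] -/
theorem quadExpCoeff_eq_model :
    Literature.Barriers.RiemannHypothesis.quadExpCoeff = fun m : ℕ => ((m : ℝ) - 0) ^ 2 - m + 1 := by
  funext m
  simp only [Literature.Barriers.RiemannHypothesis.quadExpCoeff]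
  ring

/-- Sanity instance `(u,ν) = (−3/2, 1)` (b-family member `b = 2/5`: positive kernel `e^{−t²}(1 + (2/5)t⁴)`, A-critical):
A holds, B fails, 𝓛𝓟 fails; `δ(0) = ⌊9/4⌋ + 2 = 4`. [folklore] -/
theorem bFamily_two_fifths :
    (∀ d n : ℕ, 1 ≤ n → (jensenPoly (fun m : ℕ => ((m : ℝ) - (-3/2 : ℝ)) ^ 2 - m + 1) d n).Splits) ∧
    ¬ (∀ d n : ℕ, (jensenPoly (fun m : ℕ => ((m : ℝ) - (-3/2 : ℝ)) ^ 2 - m + 1) d n).Splits) ∧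
    ¬ (∀ d : ℕ, 2 ≤ d → ∀ x : ℝ,
        (derivative (jensenPoly (fun m : ℕ => ((m : ℝ) - (-3/2 : ℝ)) ^ 2 - m + 1) d 0)).eval x = 0 →
        (jensenPoly (fun m : ℕ => ((m : ℝ) - (-3/2 : ℝ)) ^ 2 - m + 1) d 0).eval x ≠ 0 →
        (jensenPoly (fun m : ℕ => ((m : ℝ) - (-3/2 : ℝ)) ^ 2 - m + 1) d 0).eval x *
          (derivative (derivative (jensenPoly (fun m : ℕ => ((m : ℝ) - (-3/2 : ℝ)) ^ 2 - m + 1) d 0))).eval x < 0) :=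
  ⟨(model_rowsFromOne_iff (by norm_num) one_pos).2 le_rfl, model_not_allHyperbolic (by norm_num) one_pos,
    model_not_rowZeroLaguerre (by norm_num) one_pos⟩

/-- `qSeq = (49/10⁴)·γ_{u*,ν*}` with `u* = −1147/98`, `ν* = 374797/4802 ≈ 78.05`: the Dimitrov–Lucas refutation
kernel `K_0 = e^{−t²}(1 + t²/10 + 49t⁴/10⁴)` of `JensenPolynomialsLogConcaveKernel.lean` (Taylor sequence
`(√π/2)4^{−m}q(m)`, `LogConcaveKernel.kernelTaylorSeq_K_zero`) is, up to the hyperbolicity-preserving rescaling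
`c·r^m`, the FAR-PAIR member `(u*,ν*)` of the family: `ν* > 78` so rows `n ≤ 78` fail and rows `n ≥ 79` are
hyperbolic (`splits_jensenPoly_K_zero_of_le`), and the tree's `cornerThreshold n = ⌊(n−u*)²/(ν*−n)⌋ + 2` is the
csc² law. [folklore] -/
theorem qSeq_eq_model :
    Literature.Barriers.RiemannHypothesis.LogConcaveKernel.qSeq =
      fun m : ℕ => (49 / 10000 : ℝ) * (((m : ℝ) - (-1147 / 98 : ℝ)) ^ 2 - m + 374797 / 4802) := by
  funext m
  simp only [Literature.Barriers.RiemannHypothesis.LogConcaveKernel.qSeq]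
  ring

/-- Hence the Jensen grid of `K_0` is the model grid at `(u*,ν*)`: cell `(e+2,n)` hyperbolic iff
`0 ≤ (n − u*)² + (e+1)(n − ν*)` (compare the tree's `splits_jensenPoly_K_zero_iff` / `cornerForm`). [folklore] -/
theorem splits_jensenPoly_K_zero_iff_model (e n : ℕ) :
    (jensenPoly (Literature.Barriers.RiemannHypothesis.kernelTaylorSeq
        (Literature.Barriers.RiemannHypothesis.LogConcaveKernel.K 0)) (e + 2) n).Splits ↔
      0 ≤ ((n : ℝ) - (-1147 / 98 : ℝ)) ^ 2 + ((e : ℝ) + 1) * ((n : ℝ) - 374797 / 4802) := by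
  rw [show Literature.Barriers.RiemannHypothesis.kernelTaylorSeq
        (Literature.Barriers.RiemannHypothesis.LogConcaveKernel.K 0) =
        fun m => Real.sqrt Real.pi / 2 * (1 / 4) ^ m * Literature.Barriers.RiemannHypothesis.LogConcaveKernel.qSeq m from
      funext Literature.Barriers.RiemannHypothesis.LogConcaveKernel.kernelTaylorSeq_K_zero,
    Literature.Barriers.RiemannHypothesis.splits_jensenPoly_const_mul_pow_mul_iff (by positivity) (by norm_num)
      Literature.Barriers.RiemannHypothesis.LogConcaveKernel.qSeq (e + 2) n,
    qSeq_eq_model,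
    show (fun m : ℕ => (49 / 10000 : ℝ) * (((m : ℝ) - (-1147 / 98 : ℝ)) ^ 2 - m + 374797 / 4802)) =
        fun m : ℕ => (49 / 10000 : ℝ) * (1 : ℝ) ^ m * (((m : ℝ) - (-1147 / 98 : ℝ)) ^ 2 - m + 374797 / 4802) from
      funext fun m => by rw [one_pow, mul_one],
    Literature.Barriers.RiemannHypothesis.splits_jensenPoly_const_mul_pow_mul_iff (by norm_num) one_ne_zero
      (fun m : ℕ => ((m : ℝ) - (-1147 / 98 : ℝ)) ^ 2 - m + 374797 / 4802) (e + 2) n]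
  exact model_splits_iff (by norm_num) (by norm_num) e n

end Summit.RiemannHypothesis.RiemannHypothesis.Theorems.Splittings.JensenX4TwoZeroModel

end
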